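import Mathlib
import HarnessLib

/-!
# Route GaugeDescent — split diagonal tori: the image of a monomial map of tori and the lattice
# step of `TorusOrbitDescent` (support for stmt-ValiantsHypothesis-6635)

Pure algebra behind the Hilbert-90 descent lemma `TorusOrbitDescent` of the route (card Lemma D):
a split torus `T = (ℂˣ)^k` acts on `ℂ^ι` diagonally through an integer weight matrix `A`
(`(t·y)_v = (∏_l t_l ^ A l v) · y_v`).

* `exists_torus_of_kernel_invariants` — **the image of the monomial map `t ↦ (∏_l t_l^{A l v})_v`
  is cut out by the kernel lattice**: if `c ∈ (ℂˣ)^ι` satisfies `∏_v c_v^{u_v} = 1` for every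
  integer vector `u` with `A u = 0`, then `c = t^A` for some `t ∈ (ℂˣ)^k`. Proof without Smith
  normal form: `u ↦ ∏ c_v^{u_v}` is a `ℤ`-linear map `ℤ^ι → ℂˣ` killing `ker A`, hence a map on
  the image lattice `A(ℤ^ι) ≤ ℤ^k`, which extends to all of `ℤ^k` because `ℂˣ` is divisible
  (`n`-th roots exist), i.e. an injective `ℤ`-module (Baer's criterion, `baer_additive_units`).
* `exists_retraction_ker` — the kernel lattice `ker A ≤ ℤ^ι` is a direct summand (its cokernel
  embeds in `ℤ^k`, so it is free, so the projection splits).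
* `exists_point_over_of_invariants` — **descent of a torus orbit to the field of its invariants**:
  if all kernel-lattice monomials `∏_v z_v^{u_v}` (`A u = 0`) of a point `z ∈ (ℂˣ)^ι` lie in a
  subfield `K₀ ⊆ ℂ`, then the `T`-orbit of `z` contains a point with all coordinates in `K₀`
  (the hom `u ↦ z^u` on `ker A` extends through the retraction to `ℤ^ι → K₀ˣ`; its values on the
  basis vectors give `y`, and `y/z` has trivial kernel-lattice monomials, so `y = t·z`).

Honest framing: a reusable Galois-descent ingredient for a conditional route; `VP ≠ VNP` is NOT
proved and nothing here is progress on it.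

## References

* G. Berhuy, *An Introduction to Galois Cohomology and its Applications* (2010), Prop. III.8.24
  (Hilbert 90: `H¹(K, 𝔾_m) = 1`, whence split tori have trivial `H¹`) and Thm. III.8.15 (descent
  lemma). [cite: Berhuy2010, Prop. III.8.24]
* Mathlib: `Module.Baer` (Baer's criterion), `Module.projective_lifting_property`.
-/

set_option linter.dupNamespace false

noncomputable section

namespace Summit.ValiantsHypothesis.ValiantsHypothesis.Theorems.GaugeDescent

open Finset

universe u

/-! ### §1. `ℂˣ` is an injective `ℤ`-module -/

/-- **`ℂˣ` is divisible, hence Baer** (as the `ℤ`-module `Additive ℂˣ`): an additive map from an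
ideal `mℤ` extends to `ℤ`, because `m`-th roots exist in `ℂ`. [folklore] -/
theorem baer_additive_units : Module.Baer ℤ (Additive ℂˣ) := by
  intro I g
  rcases IsPrincipalIdealRing.principal I with ⟨m, rfl⟩
  rcases eq_or_ne m 0 with rfl | h0
  · refine ⟨0, fun n hn => ?_⟩
    have hn0 : n = 0 := by simpa [Ideal.span_singleton_eq_bot.mpr rfl] using hn
    subst hn0
    have : (⟨0, hn⟩ : Ideal.span ({0} : Set ℤ)) = 0 := rfl
    rw [this, map_zero, map_zero]
  · have hmem : m ∈ Ideal.span ({m} : Set ℤ) := Ideal.subset_span rfl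
    set w : ℂˣ := Additive.toMul (g ⟨m, hmem⟩) with hw
    -- an `m`-th root of `w` in `ℂˣ`
    obtain ⟨r, hr⟩ : ∃ r : ℂˣ, r ^ m = w := by
      have hn : 0 < m.natAbs := Int.natAbs_pos.mpr h0
      obtain ⟨r₀, hr₀⟩ := IsAlgClosed.exists_pow_nat_eq (w : ℂ) hn
      have hr₀0 : r₀ ≠ 0 := by
        intro h
        rw [h, zero_pow hn.ne'] at hr₀
        exact w.ne_zero hr₀.symm
      have hunit : (Units.mk0 r₀ hr₀0) ^ m.natAbs = w := by
        ext
        simp [hr₀]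
      rcases Int.natAbs_eq m with hm | hm
      · refine ⟨Units.mk0 r₀ hr₀0, ?_⟩
        rw [hm, zpow_natCast, hunit]
      · refine ⟨(Units.mk0 r₀ hr₀0)⁻¹, ?_⟩
        rw [hm, inv_zpow', neg_neg, zpow_natCast, hunit]
    refine ⟨LinearMap.toSpanSingleton ℤ (Additive ℂˣ) (Additive.ofMul r), fun n hn => ?_⟩
    rcases Ideal.mem_span_singleton'.mp hn with ⟨a, rfl⟩
    have hg : g ⟨a * m, hn⟩ = a • g ⟨m, hmem⟩ := by
      rw [← map_zsmul]
      congr 1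
    have hgw : g ⟨m, hmem⟩ = Additive.ofMul w := by
      rw [hw]
      rfl
    rw [hg, LinearMap.toSpanSingleton_apply, hgw, ← ofMul_zpow, ← ofMul_zpow, mul_comm, zpow_mul,
      hr]

/-! ### §2. The image of a monomial map of split tori -/

section Torus

variable {ι : Type} [Fintype ι] {k : ℕ}

/-- `a ^ (Σ_i f i) = ∏_i a ^ (f i)` for integer exponents in a commutative group. [folklore] -/
theorem zpow_sum' {G : Type*} [CommGroup G] {β : Type*} (a : G) (f : β → ℤ) (s : Finset β) :
    a ^ (∑ b ∈ s, f b) = ∏ b ∈ s, a ^ f b := by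
  classical
  induction s using Finset.induction_on with
  | empty => simp
  | insert b s hb ih => rw [sum_insert hb, prod_insert hb, zpow_add, ih]

/-- The weight map `u ↦ A u` (`(A u)_l = Σ_v A l v · u_v`, composition of characters with the
monomial map of tori) is Mathlib's `Matrix.mulVecLin`. [folklore] -/
theorem mulVecLin_of_apply (A : Fin k → ι → ℤ) (u : ι → ℤ) (l : Fin k) :
    Matrix.mulVecLin (Matrix.of A) u l = ∑ v, A l v * u v := by
  simp [Matrix.mulVec, dotProduct]

/-- On a basis vector the weight map returns the column `v` of `A`. [folklore] -/
theorem mulVecLin_of_single [DecidableEq ι] (A : Fin k → ι → ℤ) (v : ι) :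
    Matrix.mulVecLin (Matrix.of A) (Pi.single v 1) = fun l => A l v := by
  funext l
  simp [mulVecLin_of_apply, Pi.single_apply]

/-- The monomial character map `u ↦ ∏_v c_v^{u_v}` : `ℤ^ι → ℂˣ` is the `ℤ`-linear map
`(Pi.basisFun ℤ ι).constr ℤ (ofMul ∘ c)` into `Additive ℂˣ`. [folklore] -/
theorem toMul_constr (c : ι → ℂˣ) (u : ι → ℤ) :
    Additive.toMul ((Pi.basisFun ℤ ι).constr ℤ (fun v => Additive.ofMul (c v)) u) =
      ∏ v, c v ^ u v := by
  classical
  rw [Module.Basis.constr_apply_fintype, toMul_sum]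
  refine prod_congr rfl fun v _ => ?_
  rw [Pi.basisFun_equivFun, LinearEquiv.refl_apply, toMul_zsmul, toMul_ofMul]

/-- On a basis vector the monomial map returns `c_v`. [folklore] -/
theorem toMul_constr_single [DecidableEq ι] (c : ι → ℂˣ) (v : ι) :
    Additive.toMul ((Pi.basisFun ℤ ι).constr ℤ (fun v => Additive.ofMul (c v)) (Pi.single v 1)) =
      c v := by
  rw [toMul_constr, prod_eq_single v]
  · simp
  · intro w _ hw
    simp [hw]
  · simp

/-- The monomial map of the torus action: `∏_v (∏_l t_l^{A l v})^{u_v} = ∏_l t_l^{(A u)_l}`. [folklore] -/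
theorem prod_torus_zpow (A : Fin k → ι → ℤ) (t : Fin k → ℂˣ) (u : ι → ℤ) :
    (∏ v, (∏ l, t l ^ A l v) ^ u v) = ∏ l, t l ^ (∑ v, A l v * u v) := by
  calc ∏ v, (∏ l, t l ^ A l v) ^ u v = ∏ v, ∏ l, t l ^ (A l v * u v) := by
        refine prod_congr rfl fun v _ => ?_
        rw [← prod_zpow]
        exact prod_congr rfl fun l _ => by rw [← zpow_mul]
    _ = ∏ l, ∏ v, t l ^ (A l v * u v) := prod_comm
    _ = ∏ l, t l ^ ∑ v, A l v * u v := prod_congr rfl fun l _ => by rw [zpow_sum']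

/-- **The image of the monomial map of split tori is cut out by the kernel lattice.** If
`c ∈ (ℂˣ)^ι` has `∏_v c_v^{u_v} = 1` for every `u ∈ ℤ^ι` with `A u = 0`, then `c_v = ∏_l t_l^{A l v}`
for some `t ∈ (ℂˣ)^k`: the character `u ↦ c^u` factors through the image lattice `A(ℤ^ι) ≤ ℤ^k` and
extends to `ℤ^k` by injectivity of the `ℤ`-module `ℂˣ` (`baer_additive_units`). (Equivalently:
`H¹` of the diagonalizable stabiliser vanishes over an algebraically closed field.)
[cite: Berhuy2010, Prop. III.8.24] -/
theorem exists_torus_of_kernel_invariants [DecidableEq ι] (A : Fin k → ι → ℤ) (c : ι → ℂˣ)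
    (hc : ∀ u : ι → ℤ, (∀ l, ∑ v, A l v * u v = 0) → ∏ v, c v ^ u v = 1) :
    ∃ t : Fin k → ℂˣ, ∀ v, (∏ l, t l ^ A l v) = c v := by
  classical
  let f : (ι → ℤ) →ₗ[ℤ] (Fin k → ℤ) := Matrix.mulVecLin (Matrix.of A)
  let γ : (ι → ℤ) →ₗ[ℤ] Additive ℂˣ := (Pi.basisFun ℤ ι).constr ℤ fun v => Additive.ofMul (c v)
  -- `γ` kills `ker f`
  have hker : LinearMap.ker f ≤ LinearMap.ker γ := by
    intro u hu
    rw [LinearMap.mem_ker] at hu ⊢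
    have hu' : ∀ l, ∑ v, A l v * u v = 0 := fun l => by
      have := congrFun hu l
      rw [mulVecLin_of_apply] at this
      exact this
    apply Additive.toMul.injective
    rw [toMul_constr, hc u hu']
    rfl
  -- factor through the image lattice
  let γbar : LinearMap.range f →ₗ[ℤ] Additive ℂˣ :=
    ((LinearMap.ker f).liftQ γ hker) ∘ₗ f.quotKerEquivRange.symm.toLinearMap
  have hγbar : ∀ u, γbar (f.rangeRestrict u) = γ u := by
    intro u
    simp only [γbar, LinearMap.coe_comp, LinearEquiv.coe_coe, Function.comp_apply]
    have : f.quotKerEquivRange.symm (f.rangeRestrict u) = (LinearMap.ker f).mkQ u := by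
      rw [LinearEquiv.symm_apply_eq]
      rfl
    rw [this, Submodule.mkQ_apply, Submodule.liftQ_apply]
  -- extend to `ℤ^k` by injectivity of `ℂˣ`
  obtain ⟨τ, hτ⟩ := baer_additive_units.extension_property (LinearMap.range f).subtype
    (LinearMap.range f).injective_subtype γbar
  refine ⟨fun l => Additive.toMul (τ (Pi.single l 1)), fun v => ?_⟩
  have h1 : (∏ l, Additive.toMul (τ (Pi.single l 1)) ^ A l v) =
      Additive.toMul (τ (fun l => A l v)) := by
    have hsum : (fun l => A l v) = ∑ l, (A l v) • (Pi.single l 1 : Fin k → ℤ) := by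
      funext l'
      simp [Finset.sum_apply, Pi.single_apply]
    rw [hsum, map_sum]
    simp only [map_zsmul]
    rw [toMul_sum]
    exact prod_congr rfl fun l _ => by rw [toMul_zsmul]
  rw [h1, ← mulVecLin_of_single A v]
  have h2 : τ (Matrix.mulVecLin (Matrix.of A) (Pi.single v 1)) =
      γbar (f.rangeRestrict (Pi.single v 1)) := by
    rw [← hτ]
    rfl
  rw [h2, hγbar, toMul_constr_single]

end Torus

/-! ### §3. The kernel lattice is a direct summand -/

section Lattice

variable {ι : Type} [Fintype ι] {k : ℕ}

/-- **The kernel lattice of an integer matrix is a direct summand of `ℤ^ι`**: there is a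
`ℤ`-linear retraction `π : ℤ^ι → ker A` (the cokernel `ℤ^ι / ker A ≅ A(ℤ^ι) ≤ ℤ^k` is torsion-free,
hence free, hence projective, so `ℤ^ι → A(ℤ^ι)` splits). [folklore] -/
theorem exists_retraction_ker (f : (ι → ℤ) →ₗ[ℤ] (Fin k → ℤ)) :
    ∃ π : (ι → ℤ) →ₗ[ℤ] LinearMap.ker f, ∀ u : LinearMap.ker f, π u = u := by
  classical
  haveI : Module.Free ℤ (LinearMap.range f) := Module.free_of_finite_type_torsion_free'
  obtain ⟨g, hg⟩ := Module.projective_lifting_property f.rangeRestrict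
    (LinearMap.id : LinearMap.range f →ₗ[ℤ] LinearMap.range f) f.surjective_rangeRestrict
  let ρ : (ι → ℤ) →ₗ[ℤ] (ι → ℤ) := LinearMap.id - g ∘ₗ f.rangeRestrict
  have hρ : ∀ u, ρ u = u - g (f.rangeRestrict u) := fun u => rfl
  have hπ : ∀ u, ρ u ∈ LinearMap.ker f := by
    intro u
    rw [LinearMap.mem_ker, hρ]
    have h1 : f (g (f.rangeRestrict u)) = f u := by
      have := congrArg (fun φ => ((φ (f.rangeRestrict u) : LinearMap.range f) : Fin k → ℤ)) hg
      simpa using this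
    simp [h1]
  refine ⟨LinearMap.codRestrict _ ρ hπ, fun u => ?_⟩
  apply Subtype.ext
  have hu : f.rangeRestrict (u : ι → ℤ) = 0 := by
    apply Subtype.ext
    simp
  simp [hρ, hu]

end Lattice

/-! ### §4. Descent of a torus orbit to the field of its kernel-lattice invariants -/

section Descent

variable {ι : Type} [Fintype ι] {k : ℕ}

/-- **Descent of a torus orbit to the field of its invariants.** Let `z ∈ (ℂˣ)^ι` and let
`K₀ ⊆ ℂ` be a subfield containing every kernel-lattice monomial `∏_v z_v^{u_v}` (`A u = 0`). Then the
`T`-orbit of `z` contains a point `y` with all coordinates in `K₀`: `y_v = (∏_l t_l^{A l v}) · z_v`.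
(Card Lemma D, the `H¹(K₀, split torus) = 1` step: the character `u ↦ z^u` of the kernel lattice
takes values in `K₀ˣ`, extends to `ℤ^ι → K₀ˣ` through a retraction onto the direct summand
`ker A`, and its values on the coordinate vectors give `y`; then `y/z` has trivial kernel-lattice
monomials, so `y ∈ T·z` by `exists_torus_of_kernel_invariants`.)
[cite: Berhuy2010, Thm. III.8.15] -/
theorem exists_point_over_of_invariants [DecidableEq ι] (A : Fin k → ι → ℤ) (K₀ : Subfield ℂ)
    (z : ι → ℂˣ)
    (hinv : ∀ u : ι → ℤ, (∀ l, ∑ v, A l v * u v = 0) → ((∏ v, z v ^ u v : ℂˣ) : ℂ) ∈ K₀) :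
    ∃ (y : ι → ℂˣ) (t : Fin k → ℂˣ),
      (∀ v, ((y v : ℂˣ) : ℂ) ∈ K₀) ∧ ∀ v, y v = (∏ l, t l ^ A l v) * z v := by
  classical
  let f : (ι → ℤ) →ₗ[ℤ] (Fin k → ℤ) := Matrix.mulVecLin (Matrix.of A)
  let γ : (ι → ℤ) →ₗ[ℤ] Additive ℂˣ := (Pi.basisFun ℤ ι).constr ℤ fun v => Additive.ofMul (z v)
  have hmemker : ∀ u : ι → ℤ, u ∈ LinearMap.ker f ↔ ∀ l, ∑ v, A l v * u v = 0 := by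
    intro u
    rw [LinearMap.mem_ker, funext_iff]
    exact forall_congr' fun l => by rw [mulVecLin_of_apply, Pi.zero_apply]
  -- the subgroup of `ℂˣ` of units of `K₀`, as a `ℤ`-submodule of `Additive ℂˣ`
  let U : Submodule ℤ (Additive ℂˣ) :=
    { carrier := {w | ((Additive.toMul w : ℂˣ) : ℂ) ∈ K₀}
      add_mem' := fun {a b} ha hb => by
        change (((Additive.toMul a * Additive.toMul b : ℂˣ)) : ℂ) ∈ K₀
        rw [Units.val_mul]
        exact K₀.mul_mem ha hb
      zero_mem' := by
        change (((1 : ℂˣ)) : ℂ) ∈ K₀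
        exact K₀.one_mem
      smul_mem' := fun n {a} ha => by
        change (((Additive.toMul a ^ n : ℂˣ)) : ℂ) ∈ K₀
        rw [Units.val_zpow_eq_zpow_val]
        exact K₀.zpow_mem ha n }
  have hmemU : ∀ w : Additive ℂˣ, w ∈ U ↔ ((Additive.toMul w : ℂˣ) : ℂ) ∈ K₀ := fun w => Iff.rfl
  -- the invariants: `u ↦ z^u` on `ker f`, with values in `U`
  have hval : ∀ u : LinearMap.ker f, γ (u : ι → ℤ) ∈ U := by
    intro u
    rw [hmemU, toMul_constr]
    exact hinv u ((hmemker u).mp u.2)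
  let χ₀ : LinearMap.ker f →ₗ[ℤ] U := LinearMap.codRestrict U (γ ∘ₗ (LinearMap.ker f).subtype) hval
  obtain ⟨π, hπ⟩ := exists_retraction_ker f
  let χ : (ι → ℤ) →ₗ[ℤ] U := χ₀ ∘ₗ π
  have hχ : ∀ u : ι → ℤ, (∀ l, ∑ v, A l v * u v = 0) →
      Additive.toMul ((χ u : U) : Additive ℂˣ) = ∏ v, z v ^ u v := by
    intro u hu
    have hu' : u ∈ LinearMap.ker f := (hmemker u).mpr hu
    have : χ u = χ₀ ⟨u, hu'⟩ := by
      change χ₀ (π u) = _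
      rw [hπ ⟨u, hu'⟩]
    rw [this, ← toMul_constr z u]
    rfl
  -- the point `y`
  let y : ι → ℂˣ := fun v => Additive.toMul ((χ (Pi.single v 1) : U) : Additive ℂˣ)
  have hyK : ∀ v, ((y v : ℂˣ) : ℂ) ∈ K₀ := fun v => (hmemU _).mp (χ (Pi.single v 1)).2
  have hymon : ∀ u : ι → ℤ, (∏ v, y v ^ u v) = Additive.toMul ((χ u : U) : Additive ℂˣ) := by
    intro u
    have hsum : u = ∑ v, (u v) • (Pi.single v 1 : ι → ℤ) := by
      funext w
      simp [Finset.sum_apply, Pi.single_apply]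
    conv_rhs => rw [hsum, map_sum]
    rw [Submodule.coe_sum, toMul_sum]
    refine prod_congr rfl fun v _ => ?_
    rw [map_zsmul, Submodule.coe_smul, toMul_zsmul]
  -- `y / z` has trivial kernel-lattice monomials, hence lies in the image of the torus
  obtain ⟨t, ht⟩ := exists_torus_of_kernel_invariants A (fun v => y v / z v) (fun u hu => by
    rw [show (∏ v, (y v / z v) ^ u v) = (∏ v, y v ^ u v) / ∏ v, z v ^ u v by
      rw [← prod_div_distrib]; exact prod_congr rfl fun v _ => div_zpow _ _ _]
    rw [hymon, hχ u hu, div_self'])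
  exact ⟨y, t, hyK, fun v => by rw [ht v, div_mul_cancel]⟩

end Descent

end Summit.ValiantsHypothesis.ValiantsHypothesis.Theorems.GaugeDescent

end
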